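import Summits.BirchSwinnertonDyer.BirchSwinnertonDyer.Theses.GoldfeldAllTwistsTwoConverse
import Summits.BirchSwinnertonDyer.BirchSwinnertonDyer.Theorems.GoldfeldGoodTwistsAllTwistsCells
import Literature.NumberTheory.EllipticCurves.BSDRootNumberSmallConductorProofs
import Literature.NumberTheory.EllipticCurves.BSDRootNumberOddParityProofs
import Literature.NumberTheory.EllipticCurves.BSDSelmerPParityUnfoldingProofs
import Literature.NumberTheory.EllipticCurves.SelmerCorankHolds
import HarnessLib

set_option linter.dupNamespace false
set_option autoImplicit false

/-!
# Crux K12₂″ / K12₂′: the CREMONA rung — the rank-one `p^∞`-converse at EVERY prime for conductor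
# `< 130000`, without an analytic-rank hypothesis

Cell `bsd-goldfeld`, prover seat `s1p-c201` (gen 2), items `stmt-BirchSwinnertonDyer-20044` (K12₂″) and
`stmt-BirchSwinnertonDyer-19349` (K12₂′). Both OPEN; nothing asserted. File 13's first rung
(`rankOneTwoConverseCMSevenAdditiveTwo_of_conductorNorm_lt`, Miller's `N < 5000`) carries the hypothesis
`W.analyticRank ≤ 1` — i.e. it assumes the hard half of the conclusion. This file removes it and widens the
range: for EVERY elliptic `W/ℚ` with `N_W < 130000` and EVERY prime `p`,
`corank_{ℤ_p} Sel_{p^∞}(W/ℚ) = 1 ⟹ ord_{s=1} L(W, s) = 1` (§1), from three printed inputs only: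

* Cremona's verification of the rank conjecture for `N < 130000` (tree fact
  `analyticRank_eq_mordellWeilRank_of_conductor_lt`, as printed in Miller 2011 §1 / Creutz–Miller 2012 §1;
  binder `hC`): `r_an = rank`;
* the PROVED corank identity `corank Sel_{p^∞} = rank + corank Ш[p^∞]`
  (`WeierstrassCurve.selmerCorank_eq_mordellWeilRank_add_holds`): `rank ≤ 1`;
* the `p`-parity theorem (Dokchitser–Dokchitser 2010 Thm. 1.4, tree fact `p_parity`, binder `hpar`):
  `corank` odd ⟹ `w(W) = −1` ⟹ `r_an` odd (tree theorem `odd_analyticRank_of_rootNumber_eq_neg_one`, which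
  needs no modularity: `w = −1` carries its own odd functional equation by definition of the tree's root number).

Hence `r_an = rank ≤ 1` and `r_an` odd, so `r_an = 1`. §2 specialises to the two route decls BY NAME with the
range hypothesis `N_W < 130000` (additive `ℚ(√−7)`-twists in range: `N = 784·d₁²` or `3136·d₁²`, i.e.
`49a1^{(d)}` for `d ∈ {−1, ±2, ±3, ±5 … }` with `784 d₁² < 130000`: `d₁ ≤ 12`, resp. `d₁ ≤ 6`). A BC5-type
witness row for the tribunal, not progress on the class statement.

No `sorry`, no definition, no instance, no notation. Binders: `analyticRank_eq_mordellWeilRank_of_conductor_lt`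
(Cremona 2006 via Miller 2011 / Creutz–Miller 2012), `p_parity` (Dokchitser–Dokchitser 2010).

References: [Cremona2006] rank tables; [Miller2011LMS] §1; [CreutzMiller2012] §1; [DokchitserDokchitserAnnals2010]
Thm. 1.4; [Greenberg1999LNM] §1.
-/

noncomputable section

open scoped Classical

open WeierstrassCurve Literature.NumberTheory.EllipticCurves

namespace Summit.BirchSwinnertonDyer.BirchSwinnertonDyer.Theorems.GoldfeldGoodTwists

/-! ## §1 The Cremona rung for every elliptic curve over `ℚ` and every prime -/

/-- **Rank-one `p^∞`-Selmer converse for conductor `< 130000`, any prime `p`.** For an elliptic `W/ℚ`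
with `N_W < 130000` and `corank_{ℤ_p} Sel_{p^∞}(W/ℚ) = 1`: `ord_{s=1} L(W, s) = 1`. Cremona (`r_an = rank`,
binder `hC`) + the proved corank identity (`rank ≤ corank = 1`) + `p`-parity (`hpar`: corank odd ⟹
`w = −1` ⟹ `r_an` odd). [cite: CreutzMiller2012, §1, remark following Thm. 1.1] [cite: Cremona2006, rank tables]
[cite: DokchitserDokchitserAnnals2010, Thm. 1.4] [cite: Greenberg1999LNM, §1 pp. 54–57] -/
theorem analyticRank_eq_one_of_selmerCorank_eq_one_of_conductorNorm_lt
    (hC : analyticRank_eq_mordellWeilRank_of_conductor_lt)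
    (hpar : ∀ (W : WeierstrassCurve ℚ) [W.IsElliptic] (p : ℕ) [Fact p.Prime], p_parity W p)
    (W : WeierstrassCurve ℚ) [W.IsElliptic] (hN : W.conductorNorm ℤ < 130000)
    (p : ℕ) [Fact p.Prime] (hsel : W.selmerCorank p = 1) : W.analyticRank = 1 := by
  have hid := W.selmerCorank_eq_mordellWeilRank_add_holds p
  have hrk : W.analyticRank = W.mordellWeilRank := hC W hN
  have hodd : Odd (W.selmerCorank p) := by rw [hsel]; exact odd_one
  have hw : W.rootNumber = -1 := (p_parity_iff_rootNumber_eq_neg_one_of_odd W p hodd).mp (hpar W p)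
  obtain ⟨k, hk⟩ := odd_analyticRank_of_rootNumber_eq_neg_one (W := W) hw
  omega

/-! ## §2 The route decls on the Cremona range -/

/-- **Rung of K12₂″ (item 20044) on `N_W < 130000`, WITHOUT an analytic-rank hypothesis** (compare file
13's `rankOneTwoConverseCMSevenAdditiveTwo_of_conductorNorm_lt`: `N < 5000` and `r_an ≤ 1` assumed). The cell
hypotheses (`j = −3375`, not good at `2`) are not used. [cite: CreutzMiller2012, §1] [cite: Cremona2006, rank tables]
[cite: DokchitserDokchitserAnnals2010, Thm. 1.4] -/
theorem rankOneTwoConverseCMSevenAdditiveTwo_of_conductorNorm_lt_130000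
    (hC : analyticRank_eq_mordellWeilRank_of_conductor_lt)
    (hpar : ∀ (W : WeierstrassCurve ℚ) [W.IsElliptic] (p : ℕ) [Fact p.Prime], p_parity W p) :
    ∀ (W : WeierstrassCurve ℚ) [W.IsElliptic] [W.IsGloballyMinimal], W.conductorNorm ℤ < 130000 →
      W.j = -3375 → ¬ W.HasGoodReductionAtPrime 2 → W.selmerCorank 2 = 1 → W.analyticRank = 1 := by
  intro W _ _ hN _ _ hsel
  haveI : Fact (2 : ℕ).Prime := ⟨Nat.prime_two⟩
  exact analyticRank_eq_one_of_selmerCorank_eq_one_of_conductorNorm_lt hC hpar W hN 2 hsel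

/-- **Rung of the parent K12₂′ (item 19349) on `N_W < 130000`** (model-free: any elliptic `W` with
`j ∈ {−3375, 16581375}`; the `j`-hypothesis is not used). [cite: CreutzMiller2012, §1] [cite: Cremona2006, rank tables]
[cite: DokchitserDokchitserAnnals2010, Thm. 1.4] -/
theorem rankOneTwoConverseCMSevenAtAnyTwo_of_conductorNorm_lt_130000
    (hC : analyticRank_eq_mordellWeilRank_of_conductor_lt)
    (hpar : ∀ (W : WeierstrassCurve ℚ) [W.IsElliptic] (p : ℕ) [Fact p.Prime], p_parity W p) :
    ∀ (W : WeierstrassCurve ℚ) [W.IsElliptic], W.conductorNorm ℤ < 130000 →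
      (W.j = -3375 ∨ W.j = 16581375) → W.selmerCorank 2 = 1 → W.analyticRank = 1 := by
  intro W _ hN _ hsel
  haveI : Fact (2 : ℕ).Prime := ⟨Nat.prime_two⟩
  exact analyticRank_eq_one_of_selmerCorank_eq_one_of_conductorNorm_lt hC hpar W hN 2 hsel

/-- **K12₂″ restricted to the Cremona range is a consequence of the crux** (trivially) — recorded so that
the rung is visibly a SPECIAL CASE of the route decl `RankOneTwoConverseCMSevenAdditiveTwo` (by name), as
the tribunal's T3 witness check reads it. [cite: CreutzMiller2012, §1] -/
theorem rankOneTwoConverseCMSevenAdditiveTwo_restrict_conductorNorm_lt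
    (h : Summit.BirchSwinnertonDyer.BirchSwinnertonDyer.Theses.GoldfeldAllTwistsTwoConverse.RankOneTwoConverseCMSevenAdditiveTwo)
    (B : ℕ) :
    ∀ (W : WeierstrassCurve ℚ) [W.IsElliptic] [W.IsGloballyMinimal], W.conductorNorm ℤ < B →
      W.j = -3375 → ¬ W.HasGoodReductionAtPrime 2 → W.selmerCorank 2 = 1 → W.analyticRank = 1 :=
  fun W _ _ _ hj hg hsel => h W hj hg hsel

end Summit.BirchSwinnertonDyer.BirchSwinnertonDyer.Theorems.GoldfeldGoodTwists

end
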